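import Summits.Ventures.ResidMod.TorsionUnramified
import Literature.AlgebraicGeometry.Motives.AbelianVarietyGoodReductionFrobenius
import HarnessLib

/-!
# Venture ResidMod — GOOD(p) from the Euler factor and the criterion of Néron–Ogg–Shafarevich
# (named fact): a good Euler factor at `p` ⟹ `HasGoodReductionAt A.X A.dim v` for `v ∣ p`

HONEST FRAMING. Theorems only; plumbing for the cell `pub-residmod`. The remaining local binder of the
census-row verdicts (`hgood₂` / `hgood₃` : `HasGoodReductionAt A.X A.dim v`, "the Jacobian has good
reduction at `p`") is NOT derivable from point counts; but it IS the conclusion of a PUBLISHED criterion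
typed in the tree as the named fact
`Literature.AlgebraicGeometry.Motives.AbelianVariety.hasGoodReductionAt_of_isUnramifiedAt`
(Serre–Tate 1968, Thm. 1, converse direction of Néron–Ogg–Shafarevich: `T_ℓ(A)` unramified at `v ∤ ℓ`
⟹ good reduction at `v`) — taken here as the hypothesis `hNOS`, NOT proved in the tree. With it, the
engines' Euler factor `L_p(A,T)` (`HasGoodEulerFactorAt`: every frame of `V_ℓ(A)`, `ℓ ≠ p`, unramified
at `v ∣ p`) yields good reduction: unramified on `V_ℓ` ⟹ unramified on `T_ℓ` (`T_ℓ(A)` free, so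
`T_ℓ ↪ V_ℓ`). So a census row's LOCAL slots become: Euler factors + numeric side conditions (kernel) +
named facts (`hNOS`, `hDel`, `hB2`); only the residual-image slots remain binders.

* `natCast_not_mem_asIdeal_of_prime_ne` — two distinct rational primes do not lie in the same place.
* `tateRep_eq_one_of_rationalTateRep_eq_one` — trivial on `V_ℓ(A)` ⟹ trivial on `T_ℓ(A)`.
* `hasGoodReductionAt_of_hasGoodEulerFactorAt` — GOOD(p) from `L_p` and `hNOS`.

References: [SerreTate1968] §1 Thm. 1; [BrumerEtAl2019] (4.1.5); [BombieriGubler2006] 10.3.9 (the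
tree's notion `HasGoodReductionAt`).
-/

noncomputable section

namespace Summit.Ventures.ResidMod

open Field IsDedekindDomain
open scoped NumberField TensorProduct
open Literature.NumberTheory.GaloisRepresentations Literature.NumberTheory.Automorphic.Paramodular
open Literature.NumberTheory.EllipticCurves
open Literature.NumberTheory.DiophantineGeometry
open Literature.AlgebraicGeometry.Motives (AbelianVariety HasGoodReductionAt)

variable {A : AbelianVariety ℚ}

/-- Two distinct rational primes `p ≠ ℓ` never lie in the same finite place of `ℚ` (`ap + bℓ = 1`).
[folklore] -/
theorem natCast_not_mem_asIdeal_of_prime_ne {p ℓ : ℕ} (hp : p.Prime) (hℓ : ℓ.Prime) (hne : ℓ ≠ p)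
    {v : HeightOneSpectrum (𝓞 ℚ)} (hv : ((p : ℕ) : 𝓞 ℚ) ∈ v.asIdeal) : ((ℓ : ℕ) : 𝓞 ℚ) ∉ v.asIdeal := by
  intro hℓv
  have hcop : IsCoprime (ℓ : ℤ) (p : ℤ) := Nat.isCoprime_iff_coprime.2 ((Nat.coprime_primes hℓ hp).2 hne)
  obtain ⟨a, b, hab⟩ := hcop
  apply v.isPrime.ne_top
  rw [Ideal.eq_top_iff_one]
  have h1 : ((a * ℓ + b * p : ℤ) : 𝓞 ℚ) = 1 := by rw [hab, Int.cast_one]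
  rw [← h1]
  push_cast
  exact v.asIdeal.add_mem (v.asIdeal.mul_mem_left _ hℓv) (v.asIdeal.mul_mem_left _ hv)

/-- **Trivial on `V_ℓ(A)` ⟹ trivial on `T_ℓ(A)`** (`T_ℓ(A)` is `ℤ_ℓ`-free, so `x ↦ 1 ⊗ x` is injective).
[cite: SerreTate1968, §1] -/
theorem tateRep_eq_one_of_rationalTateRep_eq_one (ℓ : ℕ) [Fact ℓ.Prime] {g : absoluteGaloisGroup ℚ}
    (hg : A.rationalTateRep ℓ g = 1) : A.tateRep ℓ g = 1 := by
  have hℓ : ((ℓ : ℕ) : ℚ) ≠ 0 := Nat.cast_ne_zero.2 (Fact.out : ℓ.Prime).ne_zero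
  haveI : Module.Free ℤ_[ℓ] (A.tateModule ℓ) := A.module_free_tateModule_holds ℓ hℓ
  have hinj : Function.Injective fun x : A.tateModule ℓ => ((1 : ℚ_[ℓ]) ⊗ₜ[ℤ_[ℓ]] x) := by
    intro m m' h
    have hRS : Function.Injective (algebraMap ℤ_[ℓ] ℚ_[ℓ]) := IsFractionRing.injective ℤ_[ℓ] ℚ_[ℓ]
    have hinj' : Function.Injective ((Algebra.linearMap ℤ_[ℓ] ℚ_[ℓ]).rTensor (A.tateModule ℓ)) :=
      Module.Flat.rTensor_preserves_injective_linearMap _ hRS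
    have h1 : (Algebra.linearMap ℤ_[ℓ] ℚ_[ℓ]).rTensor (A.tateModule ℓ) ((1 : ℤ_[ℓ]) ⊗ₜ[ℤ_[ℓ]] m) =
        (Algebra.linearMap ℤ_[ℓ] ℚ_[ℓ]).rTensor (A.tateModule ℓ) ((1 : ℤ_[ℓ]) ⊗ₜ[ℤ_[ℓ]] m') := by
      simpa using h
    simpa using congrArg (TensorProduct.lid ℤ_[ℓ] (A.tateModule ℓ)) (hinj' h1)
  refine LinearMap.ext fun x => hinj ?_
  have h1 := congrArg (fun f => f ((1 : ℚ_[ℓ]) ⊗ₜ[ℤ_[ℓ]] x)) hg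
  simp only [Literature.AlgebraicGeometry.Motives.AbelianVariety.rationalTateRep,
    rationalTateRepresentation_apply_tmul, Module.End.one_apply] at h1
  show ((1 : ℚ_[ℓ]) ⊗ₜ[ℤ_[ℓ]] (A.tateRep ℓ g x)) = (1 : ℚ_[ℓ]) ⊗ₜ[ℤ_[ℓ]] ((1 : Module.End ℤ_[ℓ] (A.tateModule ℓ)) x)
  rw [Literature.AlgebraicGeometry.Motives.AbelianVariety.tateRep_apply_apply, Module.End.one_apply]
  exact h1

/-- **GOOD(p) from the Euler factor, GIVEN Néron–Ogg–Shafarevich** (named fact `hNOS`, Serre–Tate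
Thm. 1): if the abelian surface `A/ℚ` has a good Euler factor at the prime `p` (`HasGoodEulerFactorAt`),
then `A` has good reduction at every `v ∣ p` (`HasGoodReductionAt A.X A.dim v`). Proof: pick a prime
`ℓ ≠ p` (`v ∤ ℓ`); the frame of `V_ℓ(A)` is unramified at `v`, hence so is `T_ℓ(A)`
(`tateRep_eq_one_of_rationalTateRep_eq_one`), and `hNOS` concludes. CONDITIONAL on `hNOS`.
[cite: SerreTate1968, §1 Thm. 1] [cite: BrumerEtAl2019, (4.1.5) p. 1164] -/
theorem hasGoodReductionAt_of_hasGoodEulerFactorAt (hA : A.dim = 2)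
    (hNOS : ∀ v : HeightOneSpectrum (𝓞 ℚ), A.hasGoodReductionAt_of_isUnramifiedAt v)
    {p : ℕ} (hp : p.Prime) {L : Polynomial ℚ} (hL : A.HasGoodEulerFactorAt p L) :
    ∀ v : HeightOneSpectrum (𝓞 ℚ), ((p : ℕ) : 𝓞 ℚ) ∈ v.asIdeal → HasGoodReductionAt A.X A.dim v := by
  intro v hv
  -- an auxiliary prime `ℓ ≠ p`
  obtain ⟨ℓ, hℓprime, hℓp⟩ : ∃ ℓ : ℕ, ℓ.Prime ∧ ℓ ≠ p := by
    by_cases h2 : p = 2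
    · exact ⟨3, Nat.prime_three, by omega⟩
    · exact ⟨2, Nat.prime_two, fun h => h2 h.symm⟩
  haveI : Fact ℓ.Prime := ⟨hℓprime⟩
  have hℓv : ((ℓ : ℕ) : 𝓞 ℚ) ∉ v.asIdeal := natCast_not_mem_asIdeal_of_prime_ne hp hℓprime hℓp hv
  obtain ⟨b, r₀, hfr⟩ := exists_isFrameOfTateRep hA ℓ
  have hunr : r₀.IsUnramifiedAt v := (hL ℓ hℓp b r₀ hfr v hv).1
  refine hNOS v ℓ hℓv (A.continuous_tateRep_holds ℓ) ?_
  intro 𝔓 h𝔓 σ hσ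
  have h1 : r₀ σ = 1 := hunr 𝔓 h𝔓 σ hσ
  have hV : A.rationalTateRep ℓ σ = 1 := by
    have h2 := congrArg (fun u : GL (Fin 4) ℚ_[ℓ] => (u : Matrix (Fin 4) (Fin 4) ℚ_[ℓ])) h1
    simp only [Units.val_one] at h2
    rw [hfr] at h2
    exact (LinearMap.toMatrix b b).injective (by rw [h2, LinearMap.toMatrix_one])
  exact tateRep_eq_one_of_rationalTateRep_eq_one ℓ hV

end Summit.Ventures.ResidMod

end
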